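import Summits.QuantumFields.YangMills.Theorems.BalabanUVNodesN19JointLawPriceCompositions

/-!
# YM-DAG node N19 (= NE7 proper) — COMPOSITIONS `h(Σ_i φ_i(x_i))` WITH LIPSCHITZ INNER FUNCTIONS cost at most `≍ d∕√(log r⁻¹)` under uniform
# mixed moments (one Jackson polynomial per string with its coefficient mass, then module 110): a class strictly below the general `d²∕(d + L)`

Cell `pub-ymgap`, HUMAN RULING D-0062 (Track A) ∕ D-0149 (work-bound push), R141 (C) wider-strategy seat `pub-ymgap-dag-n19-e` (strategy
s3 = ALTERNATIVE CURRENCY), generation g27, module 6 (lineage module 111).  Route `Summits/QuantumFields/YangMills/Theses/BalabanUVNodes.lean`,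
cluster item K3⁸ «SpineGivenEndpointR13SepCoPHV» (stmt-QuantumFields-27366); filed `--supports` that item `--as helper` (it proves no registered
stub).  COUNT-NEUTRAL: [folklore] approximation theory over Mathlib and the lineage BY NAME — module 110 `…N19JointLawPriceCompositions`
(`law_price_link_le_of_uniformMixedMoments`), modules 60∕61 `…N19DiscreteJacksonTensor` ∕ `…N19DiscreteJacksonPricing` (the node weights
`jacksonWeight_nonneg` ∕ `sum_jacksonWeight_eq_one` ∕ `sum_jacksonWeight_mul_abs_cos_sub_le` and node polynomials `eval_jacksonPoly_cos` ∕
`natDegree_jacksonPoly_le` ∕ `sum_sum_abs_coeff_jacksonPoly_le`), module 65 (`abs_integral_le_of_cube`),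
p568465 (`integrable_of_continuous_of_cube`); no scheme object, no Theses import; NOT a discharge claim.

THE CLASS.  `F(x) = h(S(x))`, `S(x) = Σ_i φ_i(x_i)` with `φ_i` continuous, `K_φ`-Lipschitz and `G_φ`-bounded on `[−1,1]`, `h` continuous,
`K`-Lipschitz and `G`-bounded on `[−d(G_φ + πK_φ), d(G_φ + πK_φ)]` (`d = |ι|`) — «generalised additive models with a Lipschitz link», e.g.
`h(Σ_i |x_i|)`, the ℓ¹-norm profiles.  Ridge functionals (module 108) and links of polynomial statistics (module 110) are LINEAR in `d` at rate
`1∕L`; the general class is `Θ(d²∕(d + L))` (module 107).  Where do Lipschitz-inner compositions sit?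
§1 ★ `exists_jacksonPoly_near`: ONE-DIMENSIONAL JACKSON WITH COEFFICIENT MASS — for `φ` `K_φ`-Lipschitz and `G_φ`-bounded on `[−1,1]` and every
   `m ≥ 1` a polynomial `p` of degree `≤ 2m` with `|φ − p| ≤ πK_φ∕m` on `[−1,1]`, coefficient mass `Λ_{2m}(p) ≤ G_φ·m·9^m` and `|p| ≤ G_φ + πK_φ∕m`
   on `[−1,1]` (modules 60∕61's node weights and node polynomials, one dimension).
§2 ★★ `law_price_lipschitzComposition_le`: for all `m₁, m₂ ≥ 1`,
   `|∫F dP − ∫F dQ| ≤ 2K d πK_φ∕m₁ + 2K d B₁ π∕m₂ + G·m₂9^{m₂}·(Λ₁∕B₁)^{2m₂}·r`, `B₁ = G_φ + πK_φ∕m₁`, `Λ₁ = max(B₁, G_φ m₁ 9^{m₁})` — replace each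
   `φ_i` by its Jackson polynomial (§1; cost `K·d·πK_φ∕m₁` per law) and apply module 110 to the polynomial statistic.
§3 ★ `law_price_lipschitzComposition_le_of_small`: at `m₁ = m₂ = m` and `r ≤ (m^{2m+2}·9^{2m²+m})⁻¹`, i.e. `log r⁻¹ ≍ 2m² log 9`:
   `≤ (2πK d (K_φ + G_φ + πK_φ) + G)∕m` — **`O(d∕√(log r⁻¹))`**, LINEAR in `d`: for `log r⁻¹ ≲ d²` strictly below the general class's worst case
   `≍ d²∕(d + log r⁻¹)`.  Whether `d∕√L` is attained by some composition, or compositions are in fact `Θ(d∕L)` like ridge functionals, is OPEN (the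
   diagonal and product witnesses of modules 66∕108 give only `d∕L`).
READING for N19 (honest): observables of the form «Lipschitz profile of a sum of one-string Lipschitz observables» of `d` strings converge at
`≲ d∕√(log R_K⁻¹)` under the uniform target — between the additive `d∕log R_K⁻¹` and the general `d²∕log R_K⁻¹`.

HONEST FRAMING (binding).  Elementary and [folklore]; ONE-SIDED (upper bound only); TOY laws; NO consumer in the DAG today; nothing of Bałaban's
instantiated; NE7 NOT PRINTED, NOT proved; N19 NOT discharged; count-neutral.  One finite `T⁴` programme at fixed `ε`; nothing continuum ∕ `ℝ⁴` ∕ OS ∕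
mass-gap ∕ Clay.  0 `def` ∕ 0 `sorry`.
-/

noncomputable section

open Real Finset MeasureTheory Polynomial

namespace Summit.QuantumFields.YangMills.Theorems.BalabanUVNodesN19JointLawPriceCompositionsLipschitz

open Summit.QuantumFields.YangMills.Theorems.BalabanUVNodesN19JointLawPriceCompositions (law_price_link_le_of_uniformMixedMoments)
open Summit.QuantumFields.YangMills.Theorems.BalabanUVNodesN19DiscreteJacksonTensor
  (jacksonWeight_nonneg sum_jacksonWeight_eq_one sum_jacksonWeight_mul_abs_cos_sub_le)
open Summit.QuantumFields.YangMills.Theorems.BalabanUVNodesN19DiscreteJacksonPricing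
  (eval_jacksonPoly_cos natDegree_jacksonPoly_le sum_sum_abs_coeff_jacksonPoly_le sum_abs_coeff_finsetSum_le)
open Summit.QuantumFields.YangMills.Theorems.BalabanUVNodesN19LawPriceJackson (sum_abs_coeff_C_mul)
open Summit.QuantumFields.YangMills.Theorems.BalabanUVNodesN19JointLawPriceDimension (abs_integral_le_of_cube)
open Summit.QuantumFields.YangMills.Theorems.BalabanUVNodesN19JointLawBernstein (integrable_of_continuous_of_cube)

variable {ι : Type*} [Fintype ι] [DecidableEq ι]

/-! ## §1 One-dimensional Jackson with coefficient mass (module 60's node weights, module 61's node polynomials) [folklore] -/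

omit [Fintype ι] [DecidableEq ι] in
/-- ★ **JACKSON WITH COEFFICIENT MASS.**  For `φ : ℝ → ℝ` with `|φ x − φ y| ≤ K_φ|x − y|` and `|φ x| ≤ G_φ` on `[−1,1]` (`0 ≤ K_φ`) and `m ≥ 1`
there is a real polynomial `p` of degree `≤ 2m` with `|φ x − p(x)| ≤ πK_φ∕m` on `[−1,1]`, coefficient mass `Σ_{k ≤ e}|[x^k]p| ≤ G_φ·m·9^m` (every
truncation `e`) and `|p(x)| ≤ G_φ + πK_φ∕m` on `[−1,1]`: `p = Σ_{a<2m} φ(cos(2πa∕2m))·Φ_a`, the node polynomials of module 61, whose values at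
`x = cos t` are the Jackson weights `W_a(t) ≥ 0` of module 60 (`Σ_a W_a = 1`, `Σ_a W_a|cos t − cos θ_a| ≤ π∕m`). [folklore] -/
theorem exists_jacksonPoly_near {φ : ℝ → ℝ} {Kφ Gφ : ℝ} (hK0 : 0 ≤ Kφ)
    (hK : ∀ x y : ℝ, x ∈ Set.Icc (-1 : ℝ) 1 → y ∈ Set.Icc (-1 : ℝ) 1 → |φ x - φ y| ≤ Kφ * |x - y|)
    (hG : ∀ x : ℝ, x ∈ Set.Icc (-1 : ℝ) 1 → |φ x| ≤ Gφ) {m : ℕ} (hm : 0 < m) :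
    ∃ p : ℝ[X], p.natDegree ≤ 2 * m ∧ (∀ x : ℝ, x ∈ Set.Icc (-1 : ℝ) 1 → |φ x - p.eval x| ≤ Kφ * (π / m)) ∧
      (∀ e : ℕ, ∑ k ∈ range (e + 1), |p.coeff k| ≤ Gφ * (m * 9 ^ m)) ∧
      ∀ x : ℝ, x ∈ Set.Icc (-1 : ℝ) 1 → |p.eval x| ≤ Gφ + Kφ * (π / m) := by
  classical
  set N : ℕ := 2 * m with hN
  have hNpos : 0 < N := by omega
  have hNm : 2 * m ≤ N := le_rfl
  -- node polynomials and weights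
  set Φ : ℕ → ℝ[X] := fun a =>
    C (1 / ((N : ℝ) * (m * (2 * m ^ 2 + 1) / 3))) *
      ∑ x ∈ (range m ×ˢ range m) ×ˢ (range m ×ˢ range m),
        C (Real.cos ((((x.1.1 : ℤ) - x.1.2 + x.2.1 - x.2.2 : ℤ) : ℝ) * (2 * π * a / N))) *
          Chebyshev.T ℝ ((x.1.1 : ℤ) - x.1.2 + x.2.1 - x.2.2) with hΦ
  set W : ℕ → ℝ → ℝ := fun a t =>
    ((∑ j₁ ∈ range m, ∑ j₂ ∈ range m, Real.cos (((j₁ : ℝ) - j₂) * (t - 2 * π * a / N))) ^ 2 +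
        (∑ j₁ ∈ range m, ∑ j₂ ∈ range m, Real.cos (((j₁ : ℝ) - j₂) * (t + 2 * π * a / N))) ^ 2) /
      (2 * N * (m * (2 * m ^ 2 + 1) / 3)) with hW
  have hΦW : ∀ (a : ℕ) (t : ℝ), (Φ a).eval (Real.cos t) = W a t := fun a t => eval_jacksonPoly_cos m N a t
  have hW0 : ∀ (a : ℕ) (t : ℝ), 0 ≤ W a t := fun a t => jacksonWeight_nonneg m N a t
  have hW1 : ∀ t : ℝ, ∑ a ∈ range N, W a t = 1 := fun t => sum_jacksonWeight_eq_one hm hNm t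
  have hWmom : ∀ t : ℝ, ∑ a ∈ range N, W a t * |Real.cos t - Real.cos (2 * π * a / N)| ≤ π / m := fun t =>
    sum_jacksonWeight_mul_abs_cos_sub_le hm hNm t
  set p : ℝ[X] := ∑ a ∈ range N, C (φ (Real.cos (2 * π * a / N))) * Φ a with hp
  have hnode : ∀ a : ℕ, Real.cos (2 * π * a / N) ∈ Set.Icc (-1 : ℝ) 1 := fun a => ⟨Real.neg_one_le_cos _, Real.cos_le_one _⟩
  have hG0 : 0 ≤ Gφ := (abs_nonneg _).trans (hG 0 ⟨by norm_num, by norm_num⟩)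
  -- evaluation at `x = cos t`
  have hpeval : ∀ t : ℝ, p.eval (Real.cos t) = ∑ a ∈ range N, φ (Real.cos (2 * π * a / N)) * W a t := by
    intro t
    rw [hp, eval_finsetSum]
    exact Finset.sum_congr rfl fun a _ => by rw [eval_mul, eval_C, hΦW]
  -- the Jackson error at `x = cos t`
  have herr : ∀ t : ℝ, |φ (Real.cos t) - p.eval (Real.cos t)| ≤ Kφ * (π / m) := by
    intro t
    have hct : Real.cos t ∈ Set.Icc (-1 : ℝ) 1 := ⟨Real.neg_one_le_cos _, Real.cos_le_one _⟩
    have hrepr : φ (Real.cos t) = ∑ a ∈ range N, φ (Real.cos t) * W a t := by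
      rw [← Finset.mul_sum, hW1 t, mul_one]
    rw [hpeval, hrepr, ← Finset.sum_sub_distrib]
    calc |∑ a ∈ range N, (φ (Real.cos t) * W a t - φ (Real.cos (2 * π * a / N)) * W a t)|
        ≤ ∑ a ∈ range N, |φ (Real.cos t) * W a t - φ (Real.cos (2 * π * a / N)) * W a t| := abs_sum_le_sum_abs _ _
      _ ≤ ∑ a ∈ range N, Kφ * (W a t * |Real.cos t - Real.cos (2 * π * a / N)|) := Finset.sum_le_sum fun a _ => by
          rw [← sub_mul, abs_mul, abs_of_nonneg (hW0 a t)]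
          calc |φ (Real.cos t) - φ (Real.cos (2 * π * a / N))| * W a t ≤ Kφ * |Real.cos t - Real.cos (2 * π * a / N)| * W a t :=
                mul_le_mul_of_nonneg_right (hK _ _ hct (hnode a)) (hW0 a t)
            _ = Kφ * (W a t * |Real.cos t - Real.cos (2 * π * a / N)|) := by ring
      _ = Kφ * ∑ a ∈ range N, W a t * |Real.cos t - Real.cos (2 * π * a / N)| := by rw [Finset.mul_sum]
      _ ≤ Kφ * (π / m) := mul_le_mul_of_nonneg_left (hWmom t) hK0
  refine ⟨p, ?_, fun x hx => ?_, fun e => ?_, fun x hx => ?_⟩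
  · -- degree
    refine natDegree_sum_le_of_forall_le _ _ fun a _ => (natDegree_C_mul_le _ _).trans (natDegree_jacksonPoly_le m N a)
  · -- error at `x = cos(arccos x)`
    have h := herr (Real.arccos x)
    rwa [Real.cos_arccos hx.1 hx.2] at h
  · -- coefficient mass
    calc ∑ k ∈ range (e + 1), |p.coeff k| ≤ ∑ a ∈ range N, ∑ k ∈ range (e + 1), |(C (φ (Real.cos (2 * π * a / N))) * Φ a).coeff k| :=
          sum_abs_coeff_finsetSum_le _ _ e
      _ = ∑ a ∈ range N, |φ (Real.cos (2 * π * a / N))| * ∑ k ∈ range (e + 1), |(Φ a).coeff k| :=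
          Finset.sum_congr rfl fun a _ => sum_abs_coeff_C_mul _ _ e
      _ ≤ ∑ a ∈ range N, Gφ * ∑ k ∈ range (e + 1), |(Φ a).coeff k| := Finset.sum_le_sum fun a _ =>
          mul_le_mul_of_nonneg_right (hG _ (hnode a)) (Finset.sum_nonneg fun _ _ => abs_nonneg _)
      _ = Gφ * ∑ a ∈ range N, ∑ k ∈ range (e + 1), |(Φ a).coeff k| := by rw [Finset.mul_sum]
      _ ≤ Gφ * (m * 9 ^ m) := mul_le_mul_of_nonneg_left (sum_sum_abs_coeff_jacksonPoly_le hm hNpos e) hG0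
  · -- size on `[−1,1]`
    have h := herr (Real.arccos x)
    rw [Real.cos_arccos hx.1 hx.2] at h
    have h1 : |p.eval x| ≤ |φ x| + |φ x - p.eval x| := by
      calc |p.eval x| = |φ x - (φ x - p.eval x)| := by ring_nf
        _ ≤ |φ x| + |φ x - p.eval x| := abs_sub _ _
    linarith [hG x hx]

/-! ## §2 ★★ Compositions with Lipschitz inner functions [folklore] -/

/-- ★★ **LIPSCHITZ-INNER COMPOSITIONS: `2Kd·πK_φ∕m₁ + 2K d B₁ π∕m₂ + G·m₂9^{m₂}·(Λ₁∕B₁)^{2m₂}·r`.**  `P, Q` on `[−1,1]^ι` with all mixed moments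
`r`-close (`0 ≤ r`); `φ_i` continuous, `K_φ`-Lipschitz and `G_φ`-bounded on `[−1,1]` (`0 < G_φ`); `h` continuous, `K`-Lipschitz and `G`-bounded on
`[−dM, dM]` with `M = G_φ + πK_φ`.  Then for all `m₁, m₂ ≥ 1`, with `B₁ = G_φ + πK_φ∕m₁` and `Λ₁ = max(B₁, G_φ m₁ 9^{m₁})`:
`|∫h(Σφ_i(x_i)) dP − ∫h(Σφ_i(x_i)) dQ| ≤ 2·K·(d·(K_φ(π∕m₁))) + (2K(dB₁)(π∕m₂) + G·(m₂9^{m₂})·((Λ₁∕B₁)^{2m₂} r))` — each `φ_i` replaced by its Jackson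
polynomial (§1), then module 110. [folklore] -/
theorem law_price_lipschitzComposition_le [Nonempty ι] {P Q : Measure (ι → ℝ)} [IsProbabilityMeasure P] [IsProbabilityMeasure Q]
    (hP : P (Set.pi Set.univ (fun _ : ι => Set.Icc (-1 : ℝ) 1))ᶜ = 0) (hQ : Q (Set.pi Set.univ (fun _ : ι => Set.Icc (-1 : ℝ) 1))ᶜ = 0)
    {r : ℝ} (hr : 0 ≤ r) (hmom : ∀ j : ι → ℕ, |∫ x, ∏ i, x i ^ j i ∂P - ∫ x, ∏ i, x i ^ j i ∂Q| ≤ r)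
    {φ : ι → ℝ → ℝ} (hφc : ∀ i, Continuous (φ i)) {Kφ Gφ : ℝ} (hKφ0 : 0 ≤ Kφ) (hGφ0 : 0 < Gφ)
    (hφK : ∀ (i : ι) (x y : ℝ), x ∈ Set.Icc (-1 : ℝ) 1 → y ∈ Set.Icc (-1 : ℝ) 1 → |φ i x - φ i y| ≤ Kφ * |x - y|)
    (hφG : ∀ (i : ι) (x : ℝ), x ∈ Set.Icc (-1 : ℝ) 1 → |φ i x| ≤ Gφ)
    {h : ℝ → ℝ} (hh : Continuous h) {K G : ℝ} (hK0 : 0 ≤ K)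
    (hK : ∀ s s' : ℝ, s ∈ Set.Icc (-(Fintype.card ι * (Gφ + π * Kφ))) (Fintype.card ι * (Gφ + π * Kφ)) →
      s' ∈ Set.Icc (-(Fintype.card ι * (Gφ + π * Kφ))) (Fintype.card ι * (Gφ + π * Kφ)) → |h s - h s'| ≤ K * |s - s'|)
    (hG : ∀ s : ℝ, s ∈ Set.Icc (-(Fintype.card ι * (Gφ + π * Kφ))) (Fintype.card ι * (Gφ + π * Kφ)) → |h s| ≤ G)
    {m₁ m₂ : ℕ} (hm₁ : 0 < m₁) (hm₂ : 0 < m₂) :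
    |∫ x, h (∑ i, φ i (x i)) ∂P - ∫ x, h (∑ i, φ i (x i)) ∂Q| ≤
      2 * (K * (Fintype.card ι * (Kφ * (π / m₁)))) +
        (2 * (K * (Fintype.card ι * (Gφ + Kφ * (π / m₁)))) * (π / m₂) +
          G * (m₂ * 9 ^ m₂) * ((max (Gφ + Kφ * (π / m₁)) (Gφ * (m₁ * 9 ^ m₁)) / (Gφ + Kφ * (π / m₁))) ^ (2 * m₂) * r)) := by
  classical
  set d : ℕ := Fintype.card ι with hd
  have hdpos : (0 : ℝ) < d := by exact_mod_cast (Fintype.card_pos : 0 < d)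
  set B₁ : ℝ := Gφ + Kφ * (π / m₁) with hB₁
  set Λ₁ : ℝ := max B₁ (Gφ * (m₁ * 9 ^ m₁)) with hΛ₁
  have hm₁r : (0 : ℝ) < m₁ := by exact_mod_cast hm₁
  have hπm : 0 ≤ Kφ * (π / m₁) := mul_nonneg hKφ0 (div_nonneg Real.pi_pos.le hm₁r.le)
  have hB₁pos : 0 < B₁ := by rw [hB₁]; linarith
  have hB₁Λ : B₁ ≤ Λ₁ := le_max_left _ _
  have hB₁M : B₁ ≤ Gφ + π * Kφ := by
    rw [hB₁]
    have : π / m₁ ≤ π := div_le_self Real.pi_pos.le (by exact_mod_cast hm₁)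
    nlinarith
  -- the Jackson polynomials of the inner functions
  have hex : ∀ i, ∃ p : ℝ[X], p.natDegree ≤ 2 * m₁ ∧ (∀ x : ℝ, x ∈ Set.Icc (-1 : ℝ) 1 → |φ i x - p.eval x| ≤ Kφ * (π / m₁)) ∧
      (∀ e : ℕ, ∑ k ∈ range (e + 1), |p.coeff k| ≤ Gφ * (m₁ * 9 ^ m₁)) ∧
      ∀ x : ℝ, x ∈ Set.Icc (-1 : ℝ) 1 → |p.eval x| ≤ Gφ + Kφ * (π / m₁) := fun i =>
    exists_jacksonPoly_near hKφ0 (hφK i) (hφG i) hm₁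
  choose p hpdeg hperr hpmass hpB using hex
  -- module 110 on the polynomial statistic
  have hKB : ∀ s s' : ℝ, s ∈ Set.Icc (-((d : ℝ) * B₁)) (d * B₁) → s' ∈ Set.Icc (-((d : ℝ) * B₁)) (d * B₁) →
      |h s - h s'| ≤ K * |s - s'| := by
    intro s s' hs hs'
    have hsub : Set.Icc (-((d : ℝ) * B₁)) (d * B₁) ⊆ Set.Icc (-((d : ℝ) * (Gφ + π * Kφ))) (d * (Gφ + π * Kφ)) :=
      Set.Icc_subset_Icc (by nlinarith [mul_le_mul_of_nonneg_left hB₁M hdpos.le]) (mul_le_mul_of_nonneg_left hB₁M hdpos.le)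
    exact hK s s' (hsub hs) (hsub hs')
  have hGB : ∀ s : ℝ, s ∈ Set.Icc (-((d : ℝ) * B₁)) (d * B₁) → |h s| ≤ G := fun s hs =>
    hG s (Set.Icc_subset_Icc (by nlinarith [mul_le_mul_of_nonneg_left hB₁M hdpos.le]) (mul_le_mul_of_nonneg_left hB₁M hdpos.le) hs)
  have hlink := law_price_link_le_of_uniformMixedMoments hP hQ hr hmom p hpdeg hB₁pos hB₁Λ
    (fun i => (hpmass i (2 * m₁)).trans (le_max_right _ _)) hpB hh hK0 hKB hGB hm₂
  -- the inner approximation, law by law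
  have hSφ : Continuous fun x : ι → ℝ => h (∑ i, φ i (x i)) :=
    hh.comp (continuous_finsetSum _ fun i _ => (hφc i).comp (continuous_apply i))
  have hSp : Continuous fun x : ι → ℝ => h (∑ i, (p i).eval (x i)) :=
    hh.comp (continuous_finsetSum _ fun i _ => (Polynomial.continuous _).comp (continuous_apply i))
  have hptw : ∀ u : ι → ℝ, (∀ i, u i ∈ Set.Icc (-1 : ℝ) 1) →
      |h (∑ i, φ i (u i)) - h (∑ i, (p i).eval (u i))| ≤ K * (d * (Kφ * (π / m₁))) := by
    intro u hu
    have hS1 : ∑ i, φ i (u i) ∈ Set.Icc (-((d : ℝ) * (Gφ + π * Kφ))) (d * (Gφ + π * Kφ)) := by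
      have hb : |∑ i, φ i (u i)| ≤ d * (Gφ + π * Kφ) := by
        calc |∑ i, φ i (u i)| ≤ ∑ i, |φ i (u i)| := abs_sum_le_sum_abs _ _
          _ ≤ ∑ _i : ι, (Gφ + π * Kφ) := Finset.sum_le_sum fun i _ => (hφG i _ (hu i)).trans (by nlinarith [Real.pi_pos])
          _ = d * (Gφ + π * Kφ) := by rw [Finset.sum_const, Finset.card_univ, nsmul_eq_mul]
      exact ⟨(abs_le.1 hb).1, (abs_le.1 hb).2⟩
    have hS2 : ∑ i, (p i).eval (u i) ∈ Set.Icc (-((d : ℝ) * (Gφ + π * Kφ))) (d * (Gφ + π * Kφ)) := by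
      have hb : |∑ i, (p i).eval (u i)| ≤ d * (Gφ + π * Kφ) := by
        calc |∑ i, (p i).eval (u i)| ≤ ∑ i, |(p i).eval (u i)| := abs_sum_le_sum_abs _ _
          _ ≤ ∑ _i : ι, (Gφ + π * Kφ) := Finset.sum_le_sum fun i _ => (hpB i _ (hu i)).trans hB₁M
          _ = d * (Gφ + π * Kφ) := by rw [Finset.sum_const, Finset.card_univ, nsmul_eq_mul]
      exact ⟨(abs_le.1 hb).1, (abs_le.1 hb).2⟩
    calc |h (∑ i, φ i (u i)) - h (∑ i, (p i).eval (u i))| ≤ K * |∑ i, φ i (u i) - ∑ i, (p i).eval (u i)| := hK _ _ hS1 hS2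
      _ ≤ K * (d * (Kφ * (π / m₁))) := mul_le_mul_of_nonneg_left (by
          rw [← Finset.sum_sub_distrib]
          calc |∑ i, (φ i (u i) - (p i).eval (u i))| ≤ ∑ i, |φ i (u i) - (p i).eval (u i)| := abs_sum_le_sum_abs _ _
            _ ≤ ∑ _i : ι, Kφ * (π / m₁) := Finset.sum_le_sum fun i _ => hperr i _ (hu i)
            _ = d * (Kφ * (π / m₁)) := by rw [Finset.sum_const, Finset.card_univ, nsmul_eq_mul]) hK0
  have happrox : ∀ (μ : Measure (ι → ℝ)) [IsProbabilityMeasure μ], μ (Set.pi Set.univ (fun _ : ι => Set.Icc (-1 : ℝ) 1))ᶜ = 0 →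
      |∫ x, h (∑ i, φ i (x i)) ∂μ - ∫ x, h (∑ i, (p i).eval (x i)) ∂μ| ≤ K * (d * (Kφ * (π / m₁))) := by
    intro μ _ hμ
    rw [← integral_sub (integrable_of_continuous_of_cube hμ hSφ) (integrable_of_continuous_of_cube hμ hSp)]
    exact abs_integral_le_of_cube hμ hptw
  -- assemble
  have hPa := happrox P hP
  have hQa := happrox Q hQ
  have key : |∫ x, h (∑ i, φ i (x i)) ∂P - ∫ x, h (∑ i, φ i (x i)) ∂Q| ≤
      |∫ x, h (∑ i, φ i (x i)) ∂P - ∫ x, h (∑ i, (p i).eval (x i)) ∂P| +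
        |∫ x, h (∑ i, (p i).eval (x i)) ∂P - ∫ x, h (∑ i, (p i).eval (x i)) ∂Q| +
        |∫ x, h (∑ i, φ i (x i)) ∂Q - ∫ x, h (∑ i, (p i).eval (x i)) ∂Q| := by
    have e : ∫ x, h (∑ i, φ i (x i)) ∂P - ∫ x, h (∑ i, φ i (x i)) ∂Q =
        (∫ x, h (∑ i, φ i (x i)) ∂P - ∫ x, h (∑ i, (p i).eval (x i)) ∂P) +
          (∫ x, h (∑ i, (p i).eval (x i)) ∂P - ∫ x, h (∑ i, (p i).eval (x i)) ∂Q) -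
          (∫ x, h (∑ i, φ i (x i)) ∂Q - ∫ x, h (∑ i, (p i).eval (x i)) ∂Q) := by ring
    rw [e]
    exact (abs_sub _ _).trans (add_le_add (abs_add_le _ _) le_rfl)
  calc |∫ x, h (∑ i, φ i (x i)) ∂P - ∫ x, h (∑ i, φ i (x i)) ∂Q|
      ≤ K * (d * (Kφ * (π / m₁))) +
          (2 * (K * (d * B₁)) * (π / m₂) + G * (m₂ * 9 ^ m₂) * ((Λ₁ / B₁) ^ (2 * m₂) * r)) +
          K * (d * (Kφ * (π / m₁))) := key.trans (add_le_add (add_le_add hPa hlink) hQa)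
    _ = 2 * (K * (d * (Kφ * (π / m₁)))) +
          (2 * (K * (d * B₁)) * (π / m₂) + G * (m₂ * 9 ^ m₂) * ((Λ₁ / B₁) ^ (2 * m₂) * r)) := by ring

/-! ## §3 ★ The optimised form: `O(d∕√(log r⁻¹))` [folklore] -/

/-- ★ **`O(d∕√(log r⁻¹))`.**  In the setting of `law_price_lipschitzComposition_le`, at `m₁ = m₂ = m` and `r ≤ (m^{2m+2}·9^{2m²+m})⁻¹` (that is,
`log r⁻¹ ≍ 2m² log 9`): `|∫h(Σφ_i(x_i)) dP − ∫h(Σφ_i(x_i)) dQ| ≤ (2πK d(K_φ + G_φ + πK_φ) + G)∕m` — LINEAR in `d` at the rate `1∕m ≍ 1∕√(log r⁻¹)`,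
strictly below the general class's `d²∕(d + log r⁻¹)` whenever `log r⁻¹ ≲ d²`; sharpness OPEN. [folklore] -/
theorem law_price_lipschitzComposition_le_of_small [Nonempty ι] {P Q : Measure (ι → ℝ)} [IsProbabilityMeasure P] [IsProbabilityMeasure Q]
    (hP : P (Set.pi Set.univ (fun _ : ι => Set.Icc (-1 : ℝ) 1))ᶜ = 0) (hQ : Q (Set.pi Set.univ (fun _ : ι => Set.Icc (-1 : ℝ) 1))ᶜ = 0)
    {r : ℝ} (hr : 0 ≤ r) (hmom : ∀ j : ι → ℕ, |∫ x, ∏ i, x i ^ j i ∂P - ∫ x, ∏ i, x i ^ j i ∂Q| ≤ r)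
    {φ : ι → ℝ → ℝ} (hφc : ∀ i, Continuous (φ i)) {Kφ Gφ : ℝ} (hKφ0 : 0 ≤ Kφ) (hGφ0 : 0 < Gφ)
    (hφK : ∀ (i : ι) (x y : ℝ), x ∈ Set.Icc (-1 : ℝ) 1 → y ∈ Set.Icc (-1 : ℝ) 1 → |φ i x - φ i y| ≤ Kφ * |x - y|)
    (hφG : ∀ (i : ι) (x : ℝ), x ∈ Set.Icc (-1 : ℝ) 1 → |φ i x| ≤ Gφ)
    {h : ℝ → ℝ} (hh : Continuous h) {K G : ℝ} (hK0 : 0 ≤ K)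
    (hK : ∀ s s' : ℝ, s ∈ Set.Icc (-(Fintype.card ι * (Gφ + π * Kφ))) (Fintype.card ι * (Gφ + π * Kφ)) →
      s' ∈ Set.Icc (-(Fintype.card ι * (Gφ + π * Kφ))) (Fintype.card ι * (Gφ + π * Kφ)) → |h s - h s'| ≤ K * |s - s'|)
    (hG : ∀ s : ℝ, s ∈ Set.Icc (-(Fintype.card ι * (Gφ + π * Kφ))) (Fintype.card ι * (Gφ + π * Kφ)) → |h s| ≤ G)
    {m : ℕ} (hm : 0 < m) (hsmall : r ≤ 1 / ((m : ℝ) ^ (2 * m + 2) * 9 ^ (2 * m ^ 2 + m))) :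
    |∫ x, h (∑ i, φ i (x i)) ∂P - ∫ x, h (∑ i, φ i (x i)) ∂Q| ≤
      (2 * π * K * (Fintype.card ι * (Kφ + Gφ + π * Kφ)) + G) / m := by
  have h1 := law_price_lipschitzComposition_le hP hQ hr hmom hφc hKφ0 hGφ0 hφK hφG hh hK0 hK hG hm hm
  set d : ℕ := Fintype.card ι with hd
  have hdpos : (0 : ℝ) < d := by exact_mod_cast (Fintype.card_pos : 0 < d)
  have hmr : (0 : ℝ) < m := by exact_mod_cast hm
  have hm1 : (1 : ℝ) ≤ m := by exact_mod_cast hm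
  set B₁ : ℝ := Gφ + Kφ * (π / m) with hB₁
  set Λ₁ : ℝ := max B₁ (Gφ * (m * 9 ^ m)) with hΛ₁
  have hπm : 0 ≤ Kφ * (π / m) := mul_nonneg hKφ0 (div_nonneg Real.pi_pos.le hmr.le)
  have hB₁pos : 0 < B₁ := by rw [hB₁]; linarith
  have h9 : (1 : ℝ) ≤ 9 ^ m := one_le_pow₀ (by norm_num)
  have hM1 : (1 : ℝ) ≤ m * 9 ^ m := by nlinarith
  -- `Λ₁ ∕ B₁ ≤ m·9^m`
  have hratio : Λ₁ / B₁ ≤ m * 9 ^ m := by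
    rw [div_le_iff₀ hB₁pos, hΛ₁]
    refine max_le ?_ ?_
    · calc B₁ = 1 * B₁ := (one_mul _).symm
        _ ≤ m * 9 ^ m * B₁ := mul_le_mul_of_nonneg_right hM1 hB₁pos.le
    · have : Gφ ≤ B₁ := by rw [hB₁]; linarith
      calc Gφ * (m * 9 ^ m) ≤ B₁ * (m * 9 ^ m) := mul_le_mul_of_nonneg_right this (by positivity)
        _ = m * 9 ^ m * B₁ := by ring
  have hratio0 : 0 ≤ Λ₁ / B₁ := div_nonneg (hB₁pos.le.trans (le_max_left _ _)) hB₁pos.le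
  have hG0 : 0 ≤ G := (abs_nonneg _).trans (hG 0 ⟨neg_nonpos.2 (by positivity), by positivity⟩)
  -- the polynomial-road remainder is `≤ G∕m`
  have hpow : (Λ₁ / B₁) ^ (2 * m) ≤ ((m : ℝ) * 9 ^ m) ^ (2 * m) := pow_le_pow_left₀ hratio0 hratio _
  have hM2 : ((m : ℝ) * 9 ^ m) ^ (2 * m) = (m : ℝ) ^ (2 * m) * 9 ^ (2 * m ^ 2) := by
    rw [mul_pow, ← pow_mul]; ring_nf
  have hden : (0 : ℝ) < (m : ℝ) ^ (2 * m + 2) * 9 ^ (2 * m ^ 2 + m) := by positivity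
  have hterm : G * (m * 9 ^ m) * ((Λ₁ / B₁) ^ (2 * m) * r) ≤ G / m := by
    have hx : (m * 9 ^ m) * ((Λ₁ / B₁) ^ (2 * m) * r) ≤ 1 / m := by
      calc (m * 9 ^ m) * ((Λ₁ / B₁) ^ (2 * m) * r)
          ≤ (m * 9 ^ m) * (((m : ℝ) ^ (2 * m) * 9 ^ (2 * m ^ 2)) * (1 / ((m : ℝ) ^ (2 * m + 2) * 9 ^ (2 * m ^ 2 + m)))) := by
            rw [← hM2]
            exact mul_le_mul_of_nonneg_left (mul_le_mul hpow hsmall hr (by positivity)) (by positivity)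
        _ = 1 / m := by
            field_simp
            ring
    calc G * (m * 9 ^ m) * ((Λ₁ / B₁) ^ (2 * m) * r) = G * ((m * 9 ^ m) * ((Λ₁ / B₁) ^ (2 * m) * r)) := by ring
      _ ≤ G * (1 / m) := mul_le_mul_of_nonneg_left hx hG0
      _ = G / m := mul_one_div _ _
  calc |∫ x, h (∑ i, φ i (x i)) ∂P - ∫ x, h (∑ i, φ i (x i)) ∂Q|
      ≤ 2 * (K * (d * (Kφ * (π / m)))) + (2 * (K * (d * B₁)) * (π / m) + G * (m * 9 ^ m) * ((Λ₁ / B₁) ^ (2 * m) * r)) := h1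
    _ ≤ 2 * (K * (d * (Kφ * (π / m)))) + (2 * (K * (d * B₁)) * (π / m) + G / m) := by linarith
    _ = (2 * π * K * (d * (Kφ + B₁)) + G) / m := by rw [hB₁]; field_simp; ring
    _ ≤ (2 * π * K * (d * (Kφ + Gφ + π * Kφ)) + G) / m := by
        refine div_le_div_of_nonneg_right ?_ hmr.le
        have hB₁M : B₁ ≤ Gφ + π * Kφ := by
          rw [hB₁]
          have : π / m ≤ π := div_le_self Real.pi_pos.le hm1
          nlinarith
        have : Kφ + B₁ ≤ Kφ + Gφ + π * Kφ := by linarith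
        nlinarith [mul_le_mul_of_nonneg_left this (by positivity : (0 : ℝ) ≤ 2 * π * K * d), Real.pi_pos]

end Summit.QuantumFields.YangMills.Theorems.BalabanUVNodesN19JointLawPriceCompositionsLipschitz

end
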